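import Summits.AtomisticToContinuum.HydrodynamicLimit.Theses.ZenoDiameterTransfer

/-!
# Birth skeleton — piece X5 `TwinPartitionAsymptotics` of the decomposition of `DiluteEntropicTwin`
(stmt-AtomisticToContinuum-12207; crux-strategist, 2026-08-17)

Two stubs and the composition `TwinPartitionAsymptotics_of` (sorry-free; sorries only in the stubs):
* `stub_logPartition_bounds` — the two-sided free-volume bound at unit mass: with `M = (4π/3)‖ρ'_s‖_∞`,
  `N log(1 − N M ε'_N³) ≤ log Z_N(s) ≤ 0` whenever `N M ε'_N³ < 1` (Maxwellian velocity integrals = 1;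
  `Z ≤ (∫ρ')^(N+1) = 1`; sequential insertion: the i-th point avoids the ≤ i excluded balls with probability
  `≥ 1 − i M ε³`; Ruelle 1969 §3.4);
* `stub_log_one_sub_schedule` — the elementary limit `N log(1 − N M ε_N³)/(N+1) → 0` when `(N+1)ε_N³ → 0`.
The composition squeezes `(N+1)⁻¹ log Z_N(s)` between the two.
-/

namespace Summit.AtomisticToContinuum.HydrodynamicLimit.Cruxes.DiluteEntropicTwin.TwinPartitionAsymptotics

set_option linter.dupNamespace false

open scoped BigOperators Topology ENNReal
open Filter Set MeasureTheory

/-- The piece (verbatim the staged sub-item `TwinPartitionAsymptotics`). -/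
def TwinPartitionAsymptotics : Prop :=
  ∀ (T' : ℝ) (ρ' θ' : ℝ → Literature.MathematicalPhysics.KineticTheory.T3 → ℝ) (u' : ℝ → Literature.MathematicalPhysics.KineticTheory.T3 → Literature.MathematicalPhysics.KineticTheory.V3), Literature.MathematicalPhysics.KineticTheory.IsHardSphereEulerSolution 0 T' ρ' u' θ' → ∀ ε' : ℕ → ℝ, (∀ N : ℕ, 0 < ε' N ∧ ε' N < 2⁻¹) → Filter.Tendsto (fun N : ℕ => ((N : ℝ) + 1) * ε' N ^ 3) Filter.atTop (nhds 0) → ∀ Φ' : (N : ℕ) → Literature.Analysis.FluidPDE.HardSphereFlow (Literature.Analysis.FluidPDE.Torus.geometry (Fin 3)) (ε' N) (N + 1), (∀ N : ℕ, MeasureTheory.IsProbabilityMeasure (Literature.Analysis.FluidPDE.particleLaw (Φ' N) (Literature.Analysis.FluidPDE.canonicalDensity (Literature.Analysis.FluidPDE.Torus.geometry (Fin 3)) (ε' N) (N + 1) (Literature.MathematicalPhysics.KineticTheory.localGibbsProfile (ρ' 0) (u' 0) (θ' 0))))) → ∀ s ∈ Set.Ico 0 T', (∫ x, ρ' s x =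 1) → Filter.Tendsto (fun N : ℕ => Real.log (Literature.Analysis.FluidPDE.canonicalPartition (Literature.Analysis.FluidPDE.Torus.geometry (Fin 3)) (ε' N) (N + 1) (Literature.MathematicalPhysics.KineticTheory.localGibbsProfile (ρ' s) (u' s) (θ' s))) / ((N : ℝ) + 1)) Filter.atTop (nhds 0)

/-- Stub 1 — two-sided free-volume bound for the canonical partition function at unit mass. -/
theorem stub_logPartition_bounds :
    ∀ (T' : ℝ) (ρ' θ' : ℝ → Literature.MathematicalPhysics.KineticTheory.T3 → ℝ) (u' : ℝ → Literature.MathematicalPhysics.KineticTheory.T3 → Literature.MathematicalPhysics.KineticTheory.V3), Literature.MathematicalPhysics.KineticTheory.IsHardSphereEulerSolution 0 T' ρ' u' θ' → ∀ ε' : ℕ → ℝ, (∀ N : ℕ, 0 < ε' N ∧ ε' N < 2⁻¹) → ∀ Φ' : (N : ℕ) → Literature.Analysis.FluidPDE.HardSphereFlow (Literature.Analysis.FluidPDE.Torus.geometry (Fin 3)) (ε' N) (N + 1), (∀ N : ℕ, MeasureTheory.IsProbabilityMeasure (Literature.Analysis.FluidPDE.particleLaw (Φ' N) (Literature.Analysis.FluidPDE.canonicalDensity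 (Literature.Analysis.FluidPDE.Torus.geometry (Fin 3)) (ε' N) (N + 1) (Literature.MathematicalPhysics.KineticTheory.localGibbsProfile (ρ' 0) (u' 0) (θ' 0))))) → ∀ s ∈ Set.Ico 0 T', (∫ x, ρ' s x = 1) → ∃ M : ℝ, 0 < M ∧ ∀ N : ℕ, (N : ℝ) * M * ε' N ^ 3 < 1 → (N : ℝ) * Real.log (1 - (N : ℝ) * M * ε' N ^ 3) ≤ Real.log (Literature.Analysis.FluidPDE.canonicalPartition (Literature.Analysis.FluidPDE.Torus.geometry (Fin 3)) (ε' N) (N + 1) (Literature.MathematicalPhysics.KineticTheory.localGibbsProfile (ρ' s) (u' s) (θ' s))) ∧ Real.log (Literature.Analysis.FluidPDE.canonicalPartition (Literature.Analysis.FluidPDE.Torus.geometry (Fin 3)) (ε' N) (N + 1) (Literature.MathematicalPhysics.KineticTheory.localGibbsProfile (ρ' s) (u' s) (θ' s))) ≤ 0 := by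
  sorry

/-- Stub 2 — the elementary dilute limit. -/
theorem stub_log_one_sub_schedule :
    ∀ (M : ℝ) (ε : ℕ → ℝ), 0 < M → (∀ N : ℕ, 0 < ε N) → Filter.Tendsto (fun N : ℕ => ((N : ℝ) + 1) * ε N ^ 3) Filter.atTop (nhds 0) → Filter.Tendsto (fun N : ℕ => (N : ℝ) * Real.log (1 - (N : ℝ) * M * ε N ^ 3) / ((N : ℝ) + 1)) Filter.atTop (nhds 0) := by
  sorry

/-- **Composition** (kernel-checked): squeeze. -/
theorem TwinPartitionAsymptotics_of : TwinPartitionAsymptotics := by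
  have hS1 := stub_logPartition_bounds
  have hS2 := stub_log_one_sub_schedule
  intro T' ρ' θ' u' hE ε' hε' h3 Φ' hprob s hs hmass
  obtain ⟨M, hM, hB⟩ := hS1 T' ρ' θ' u' hE ε' hε' Φ' hprob s hs hmass
  have hlow := hS2 M ε' hM (fun N => (hε' N).1) h3
  -- eventually `N M ε'_N³ < 1`
  have hev : ∀ᶠ N : ℕ in Filter.atTop, (N : ℝ) * M * ε' N ^ 3 < 1 := by
    have h1 : ∀ᶠ N : ℕ in Filter.atTop, ((N : ℝ) + 1) * ε' N ^ 3 < M⁻¹ :=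
      h3.eventually (gt_mem_nhds (inv_pos.mpr hM))
    filter_upwards [h1] with N hN
    have hε3 : 0 ≤ ε' N ^ 3 := pow_nonneg (hε' N).1.le 3
    calc (N : ℝ) * M * ε' N ^ 3 = M * ((N : ℝ) * ε' N ^ 3) := by ring
      _ ≤ M * (((N : ℝ) + 1) * ε' N ^ 3) := by gcongr; linarith
      _ < M * M⁻¹ := by gcongr
      _ = 1 := mul_inv_cancel₀ hM.ne'
  refine tendsto_of_tendsto_of_tendsto_of_le_of_le' hlow tendsto_const_nhds ?_ ?_
  · filter_upwards [hev] with N hN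
    have hpos : (0 : ℝ) < (N : ℝ) + 1 := by positivity
    exact div_le_div_of_nonneg_right (hB N hN).1 hpos.le
  · filter_upwards [hev] with N hN
    have hpos : (0 : ℝ) < (N : ℝ) + 1 := by positivity
    exact div_nonpos_of_nonpos_of_nonneg (hB N hN).2 hpos.le

end Summit.AtomisticToContinuum.HydrodynamicLimit.Cruxes.DiluteEntropicTwin.TwinPartitionAsymptotics
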